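import Summits.HodgeConjecture.HodgeConjecture.Theorems.VHCAbelianSchemesRoadComplexAtiyahPullback
import Summits.HodgeConjecture.HodgeConjecture.Theorems.VHCAbelianSchemesRoadDerivedDescentBaseChangeNatTrans
import Summits.HodgeConjecture.HodgeConjecture.Theorems.VHCAbelianSchemesRoadNowhereDisplaceableDefs
import Summits.Ventures.HSemireg.HomComplexSigmaOfSchemeIso
import Literature.AlgebraicGeometry.HodgeTheory.HomComplexUnitPullback
import Literature.AlgebraicGeometry.Motives.AbelianVarietyIsogenyPullbackExact
import HarnessLib

/-!
# Road №4 (`VHCAbelianSchemesRoad`), crux stmt-HodgeConjecture-26512 `DiagLocalOfMarkmanPinnedForall` — support line «sigma-descent-along-q»,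
# library item (L2) `SigmaPullbackCompat`: **`σ_q` COMMUTES WITH THE PULL-BACK BY A FLAT MORPHISM OF `S`-SCHEMES** — the assembly of
# (Q1)–(Q5) into the pull-back twin of `Summits/Ventures/HSemireg/HomComplexSigmaOfSchemeIso.mapShiftedHom_sigmaC`, and (Dq-σ)'s body
# `SigmaPullbackCompatAt` at every secant quotient datum

research route conditional on HC_CM; not a corollary; Q11.4-sentence-2 already refuted in dim ≥ 3.

Seat core-w5 gen 6 (width copy «width 5» of core-D; claim-free, `--supports stmt-HodgeConjecture-26512 --as helper`; director-hodge g18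
R18.14 ∕ R18.17 (2) «LAST: the (Dq-σ) composition = (L2) assembly (g6 taker)», owner of record R18.20). HONEST FRAMING: kernel bookkeeping on
the venture's real carriers (`HomComplex.sigmaC` = `Q(unit) · Φ_K(x · ι• · At^q) · Q(Tr•^H)`, `mapShiftedHom`); an INFRASTRUCTURE theorem of
finite-flat descent type (Buchweitz–Flenner §3: `At`, `Tr`, the unit are functorial under flat base change). It proves NOTHING about (U-Σ), (N-U),
(S4), the crux 26512, №4, HC_AV, HC_CM or HC; HC_CM HELD, by name only; typed ≠ proved. Declared in the cell's namespace
`Summit.HodgeConjecture.HodgeConjecture.Ring2.SemiregularRepresentatives`, with the venture's names opened. `Cruxes/…/SigmaDescent.lean` is NOT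
imported (Theorems import no Cruxes): §3 proves the BODY of its `SigmaPullbackCompatAt D E` with `pullbackExt`, `unitSingleComparison`,
`formsSingleComparison` unfolded (all three are `def`s there with the bodies used here), so the line owner's bind of `stub_sigmaPullbackCompat` is
`fun D E _ a b _ _ hE q₀ x => sigmaPullbackCompatAt_body D E a b hE q₀ x` up to `delta`.

For a morphism `g : X₀ ⟶ X₁` of `S`-schemes with `g^* := Scheme.Modules.pullback g.left` EXACT (`[PreservesFiniteLimits g^*]`, e.g. `g` flat),
`g^{**} := mapShiftedHom g^*`, `K ∈ [a, b]` on `X₁` with finite locally free terms, `K' = g^*•K`: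

* §1 the two single-degree comparisons `pullbackUnitSingleComparison g : g^*•(𝒪_{X₁}[0]) ⟶ 𝒪_{X₀}[0]` (`= [sMHC] ≫ [g^*(g♯) ≫ ε]`) and
  `pullbackFormsSingleComparison g q : g^*•(Ω^q_{X₁}[0]) ⟶ Ω^q_{X₀}[0]` (`= [sMHC] ≫ [dg]`), and (Q2), (Q3′), (Q5) in this spelling:
  `map_unit_comp_pullback` (`g^*•(unit_K) ≫ τ_K = u ≫ unit_{K'}`, from `Literature…HomComplexUnitPullback`),
  `mapShiftedHom_phi_comp_pullback` (`g^{**}(Φ_K(y)) ≫ [Q τ_L]⟦n⟧ = [Q τ_A] ≫ Φ_{K'}(g^{**}y)`, (Q3′) at `τ = homFunctorPullbackHom`),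
  `map_supertraceH_comp_pullbackFormsSingleComparison` ((Q5) `…SupertracePullback`);
* §2 **`mapShiftedHom_sigmaC_pullback`** — `[Q u] ≫ σ_q^{K'}(g^{**}x) = g^{**}(σ_q^K(x)) ≫ [Q dg•]⟦q+2⟧` for every `x ∈ Ext²(K, K)`:
  the unit by (Q2), the middle factor by (Q3′)+(Q4) (`mapShiftedHom_extMulAtiyahPower_comp_pullback`), the supertrace by (Q5) — ONE-SIDED
  (all comparisons are morphisms; no inverse is used);
* §3 **`sigmaPullbackCompatAt_body`** — the same at `g := D.q` (the quotient isogeny of a `SecantQuotientDatum`, exact by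
  `IsIsogeny.preservesFiniteLimits_pullback`), the route's ambient `HasDerivedCategory.standard`, every `E` on `Y` in `[a, b]` with vector-bundle
  terms, every `q₀` and every `x` — VERBATIM the body of `SigmaDescent.SigmaPullbackCompatAt D E`.

References: R.-O. Buchweitz, H. Flenner, Compositio Math. 137 (2003), §3 (functoriality of the Atiyah class and the trace under base change),
Def. 4.1 [BuchweitzFlenner2003]; E. Markman (2025), §9.3 Lemma 9.3.9 (the commutative square with edges `σ` and `q^*σ`) [Markman2025SecantWeil];
C. A. Weibel (1994), §10.4 [Weibel1994]; R. Hartshorne (1977), II §5 p. 110, II Prop. 8.11 [Hartshorne1977]; The Stacks project, Tag 02N2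
(flat pull-back is exact), Tag 01AK [StacksProject]. Bookkeeping along a flat pull-back (reading; no printed statement is typed verbatim).
-/

noncomputable section

-- `TopCat.Presheaf`/`Scheme.Modules` are not reducible (as in Mathlib's `AlgebraicGeometry/Modules/Sheaf.lean`).
set_option backward.isDefEq.respectTransparency false

open CategoryTheory CategoryTheory.Category CategoryTheory.Limits AlgebraicGeometry Opposite
open AlgebraicGeometry.Scheme.Modules DerivedCategory

universe w₀ w₁ u

namespace Summit.HodgeConjecture.HodgeConjecture.Ring2.SemiregularRepresentatives

set_option linter.dupNamespace false -- the cell's namespace repeats the summit name, as in every `Ring2*` file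

open Literature.AlgebraicGeometry.Modules Literature.AlgebraicGeometry.Motives Literature.AlgebraicGeometry.Motives.AbelianVariety
open Literature.AlgebraicGeometry.HodgeTheory (pullbackForms singleMap_inv_comp_map_unit_comp_homComplexPullbackHom)
open Summit.Ventures.HSemireg Summit.Ventures.HSemireg.HomComplex
open Summit.HodgeConjecture.HodgeConjecture.Ring2.SemiregularRepresentatives.NowhereDisplaceable (quotientPullbackComplex)

variable {S : Type u} [CommRing S] {X₀ X₁ : Over (Spec (CommRingCat.of S))} (g : X₀ ⟶ X₁)

/-! ## §1 The single-degree comparisons; (Q2), (Q3′), (Q5) in the spelling of this file -/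

section Ends

/-- **`g^*•(𝒪_{X₁}[0]) ⟶ 𝒪_{X₀}[0]`**: single complexes commute with `g^*•` (Mathlib `singleMapHomologicalComplex`), then `[g^*(g♯) ≫ ε]`
(`g^*𝒪_{X₁} ⟶ 𝒪_{X₀}`, an isomorphism — `Modules/PullbackAlgebraUnit`). The body of `SigmaDescent.unitSingleComparison` for a general `g`.
[cite: StacksProject, Tag 01AK] -/
def pullbackUnitSingleComparison :
    ((Scheme.Modules.pullback g.left).mapHomologicalComplex (ComplexShape.up ℤ)).obj
        ((HomologicalComplex.single X₁.left.Modules (ComplexShape.up ℤ) 0).obj (unitModule X₁.left)) ⟶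
      (HomologicalComplex.single X₀.left.Modules (ComplexShape.up ℤ) 0).obj (unitModule X₀.left) :=
  (HomologicalComplex.singleMapHomologicalComplex (Scheme.Modules.pullback g.left) (ComplexShape.up ℤ) 0).hom.app (unitModule X₁.left) ≫
    (HomologicalComplex.single X₀.left.Modules (ComplexShape.up ℤ) 0).map
      ((Scheme.Modules.pullback g.left).map (algebraUnit g.left) ≫
        (Scheme.Modules.pullbackPushforwardAdjunction g.left).counit.app (unitModule X₀.left))

/-- **`g^*•(Ω^q_{X₁}[0]) ⟶ Ω^q_{X₀}[0]`**: single complexes commute with `g^*•`, then `[dg]` on `q`-forms (`pullbackForms`). The body of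
`SigmaDescent.formsSingleComparison` for a general `g`. [cite: Hartshorne1977, II Prop. 8.11] -/
def pullbackFormsSingleComparison (q : ℕ) :
    ((Scheme.Modules.pullback g.left).mapHomologicalComplex (ComplexShape.up ℤ)).obj
        ((HomologicalComplex.single X₁.left.Modules (ComplexShape.up ℤ) 0).obj (hodgeSheaf X₁ q)) ⟶
      (HomologicalComplex.single X₀.left.Modules (ComplexShape.up ℤ) 0).obj (hodgeSheaf X₀ q) :=
  (HomologicalComplex.singleMapHomologicalComplex (Scheme.Modules.pullback g.left) (ComplexShape.up ℤ) 0).hom.app (hodgeSheaf X₁ q) ≫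
    (HomologicalComplex.single X₀.left.Modules (ComplexShape.up ℤ) 0).map (pullbackForms g q)

variable (K : CochainComplex X₁.left.Modules ℤ) (a b : ℤ) [K.IsStrictlyGE a] [K.IsStrictlyLE b]
  (hK : ∀ p, IsFiniteLocallyFree (K.X p))
  (hK' : ∀ p, IsFiniteLocallyFree ((((Scheme.Modules.pullback g.left).mapHomologicalComplex (ComplexShape.up ℤ)).obj K).X p))

/-- **(Q2) in this spelling**: `g^*•(unit_K) ≫ τ_K = u ≫ unit_{g^*•K}` (`Literature…singleMap_inv_comp_map_unit_comp_homComplexPullbackHom`;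
the venture and Literature copies of `HomComplex.unit` agree definitionally).
[cite: BuchweitzFlenner2003, §2, Def. 4.1 and §3 (the unit of the trace formalism is compatible with base change)] -/
theorem map_unit_comp_pullback :
    ((Scheme.Modules.pullback g.left).mapHomologicalComplex (ComplexShape.up ℤ)).map (unit X₁.left K a b) ≫
        homFunctorPullbackHomApp g.left K K =
      pullbackUnitSingleComparison g ≫
        unit X₀.left (((Scheme.Modules.pullback g.left).mapHomologicalComplex (ComplexShape.up ℤ)).obj K) a b := by
  have h := singleMap_inv_comp_map_unit_comp_homComplexPullbackHom g.left K a b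
  rw [← cancel_epi ((HomologicalComplex.singleMapHomologicalComplex (Scheme.Modules.pullback g.left) (ComplexShape.up ℤ) 0).inv.app
    (unitModule X₁.left))]
  simp only [pullbackUnitSingleComparison, Category.assoc, Iso.inv_hom_id_app_assoc]
  exact h

/-- **(Q5) in this spelling**: `g^*•(Tr•^H_K) ≫ dg• = τ_{K ⊗ Ω^q} ≫ 𝓗om•(g^*•K, α_q•) ≫ Tr•^H_{g^*•K}` (`map_supertraceH_comp_pullbackForms`).
[cite: BuchweitzFlenner2003, §3 and §4 (the trace map is compatible with base change)] -/
theorem map_supertraceH_comp_pullbackFormsSingleComparison (q : ℕ) :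
    ((Scheme.Modules.pullback g.left).mapHomologicalComplex (ComplexShape.up ℤ)).map (supertraceH X₁ K hK q) ≫
        pullbackFormsSingleComparison g q =
      homFunctorPullbackHomApp g.left K (twistHodgeComplex X₁ q K) ≫
        (homFunctor X₀.left (((Scheme.Modules.pullback g.left).mapHomologicalComplex (ComplexShape.up ℤ)).obj K)).map
            (twistHodgeComplexPullbackHom g q K hK) ≫
          supertraceH X₀ (((Scheme.Modules.pullback g.left).mapHomologicalComplex (ComplexShape.up ℤ)).obj K) hK' q :=
  map_supertraceH_comp_pullbackForms g K hK hK' q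

variable [HasDerivedCategory.{w₀} X₀.left.Modules] [HasDerivedCategory.{w₁} X₁.left.Modules]
  [PreservesFiniteLimits (Scheme.Modules.pullback g.left)]

/-- **(Q3′) in this spelling**: `g^{**}(Φ_K(y)) ≫ [Q τ_L]⟦n⟧ = [Q τ_A] ≫ Φ_{g^*•K}(g^{**}(y))` for `y : Q A ⟶ (Q L)⟦n⟧`
(`mapShiftedHom_shiftedHomMap_of_natTrans` at the shift-compatible natural transformation `τ = homFunctorPullbackHom`).
[cite: Weibel1994, §10.4 and Cor. 10.4.7] -/
theorem mapShiftedHom_phi_comp_pullback {A L : CochainComplex X₁.left.Modules ℤ} {n : ℤ} (y : ShiftedHom (Q.obj A) (Q.obj L) n) :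
    mapShiftedHom (Scheme.Modules.pullback g.left) (shiftedHomMap (homFunctor X₁.left K) (homFunctor_isInvertedBy X₁ K a b hK) y) ≫
        (Q.map (homFunctorPullbackHomApp g.left K L))⟦n⟧' =
      Q.map (homFunctorPullbackHomApp g.left K A) ≫
        shiftedHomMap (homFunctor X₀.left (((Scheme.Modules.pullback g.left).mapHomologicalComplex (ComplexShape.up ℤ)).obj K))
          (homFunctor_isInvertedBy X₀ _ a b hK') (mapShiftedHom (Scheme.Modules.pullback g.left) y) := by
  haveI := homFunctorPullbackHom_commShift g.left K
  exact mapShiftedHom_shiftedHomMap_of_natTrans (Scheme.Modules.pullback g.left) (homFunctor X₁.left K) (homFunctor X₀.left _)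
    (homFunctor_isInvertedBy X₁ K a b hK) (homFunctor_isInvertedBy X₀ _ a b hK') (homFunctorPullbackHom g.left K) y

end Ends

/-! ## §2 `σ_q` along `g^{**}` -/

section Sigma

/-- `f ≫ ((U · P) · t) = ((f ≫ U) · P) · t` for a `sigmaC`-shaped composite whose last composition CASTS the degree. [folklore] -/
theorem comp_sigmaShape {D : Type*} [Category D] [HasShift D ℤ] {A₀ A₁ B M Z : D} {n c : ℤ}
    (f : A₀ ⟶ A₁) (U : A₁ ⟶ B) (P : ShiftedHom B M n) (t : M ⟶ Z) (hc : (0 : ℤ) + n = c) :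
    f ≫ ((ShiftedHom.mk₀ (0 : ℤ) rfl U).comp P (add_zero n)).comp (ShiftedHom.mk₀ (0 : ℤ) rfl t) hc =
      ((ShiftedHom.mk₀ (0 : ℤ) rfl (f ≫ U)).comp P (add_zero n)).comp (ShiftedHom.mk₀ (0 : ℤ) rfl t) hc := by
  have h := comp_sigmaShape_comp f U P t (𝟙 Z) hc
  rwa [CategoryTheory.Functor.map_id, Category.comp_id, Category.comp_id] at h

/-- `((U · P) · t) ≫ g⟦c⟧ = (U · P) · (t ≫ g)` for a `sigmaC`-shaped composite whose last composition CASTS the degree. [folklore] -/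
theorem sigmaShape_comp {D : Type*} [Category D] [HasShift D ℤ] {A₁ B M Z Z₀ : D} {n c : ℤ}
    (U : A₁ ⟶ B) (P : ShiftedHom B M n) (t : M ⟶ Z) (g : Z ⟶ Z₀) (hc : (0 : ℤ) + n = c) :
    ((ShiftedHom.mk₀ (0 : ℤ) rfl U).comp P (add_zero n)).comp (ShiftedHom.mk₀ (0 : ℤ) rfl t) hc ≫ (shiftFunctor D c).map g =
      ((ShiftedHom.mk₀ (0 : ℤ) rfl U).comp P (add_zero n)).comp (ShiftedHom.mk₀ (0 : ℤ) rfl (t ≫ g)) hc := by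
  have h := comp_sigmaShape_comp (𝟙 A₁) U P t g hc
  rwa [Category.id_comp, Category.id_comp] at h

variable (K : CochainComplex X₁.left.Modules ℤ) (a b : ℤ) [K.IsStrictlyGE a] [K.IsStrictlyLE b]
  (hK : ∀ p, IsFiniteLocallyFree (K.X p))
  (hK' : ∀ p, IsFiniteLocallyFree ((((Scheme.Modules.pullback g.left).mapHomologicalComplex (ComplexShape.up ℤ)).obj K).X p))
  [HasDerivedCategory.{w₀} X₀.left.Modules] [HasDerivedCategory.{w₁} X₁.left.Modules]
  [PreservesFiniteLimits (Scheme.Modules.pullback g.left)]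

/-- **`σ_q` ALONG A FLAT PULL-BACK**: for `x ∈ Ext²(K, K) = Hom_D(Q K, (Q K)⟦2⟧)`,
`[Q u] ≫ σ_q^{g^*•K}(g^{**} x) = g^{**}(σ_q^K(x)) ≫ [Q dg•]⟦q+2⟧` as morphisms `Q(g^*•𝒪_{X₁}[0]) ⟶ (Q Ω^q_{X₀}[0])⟦q+2⟧` — the unit by (Q2),
the middle factor `Φ_K(x·ι•·At^q)` by (Q3′)+(Q4), the supertrace by (Q5); the finite-flat PULL-BACK twin of the venture's `mapShiftedHom_sigmaC`
(isomorphism case) and of THEOREM T′'s (At)+(Tr) (push-forward case). [cite: BuchweitzFlenner2003, §3 and Def. 4.1 (σ = Tr(∗ · exp(−At)) is compatible with flat base change)]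
[cite: Markman2025SecantWeil, §9.3 Lemma 9.3.9 (the commutative square with edges σ and q^*σ)] -/
theorem mapShiftedHom_sigmaC_pullback (q : ℕ) (x : ShiftedHom (Q.obj K) (Q.obj K) (2 : ℤ)) :
    Q.map (pullbackUnitSingleComparison g) ≫
        sigmaC X₀ (((Scheme.Modules.pullback g.left).mapHomologicalComplex (ComplexShape.up ℤ)).obj K) a b hK' q
          (mapShiftedHom (Scheme.Modules.pullback g.left) x) =
      mapShiftedHom (Scheme.Modules.pullback g.left) (sigmaC X₁ K a b hK q x) ≫
        (shiftFunctor _ ((q + 2 : ℕ) : ℤ)).map (Q.map (pullbackFormsSingleComparison g q)) := by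
  -- (Q4): the argument of `Φ`
  have hy := mapShiftedHom_extMulAtiyahPower_comp_pullback g K hK q x
  -- (Q3′)+(Q4), solved for `g^{**}(Φ_K(y))` followed by `[Q τ_L] ≫ [Q 𝓗om•(K', α•)]`
  have hΦ : mapShiftedHom (Scheme.Modules.pullback g.left) (phiMulAtiyahPower X₁ K a b hK q x) ≫
      (shiftFunctor _ ((q : ℤ) + 2)).map (Q.map (homFunctorPullbackHomApp g.left K (twistHodgeComplex X₁ q K))) ≫
        (shiftFunctor _ ((q : ℤ) + 2)).map (Q.map ((homFunctor X₀.left _).map (twistHodgeComplexPullbackHom g q K hK))) =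
      Q.map (homFunctorPullbackHomApp g.left K K) ≫
        phiMulAtiyahPower X₀ (((Scheme.Modules.pullback g.left).mapHomologicalComplex (ComplexShape.up ℤ)).obj K) a b hK' q
          (mapShiftedHom (Scheme.Modules.pullback g.left) x) := by
    have h3 := mapShiftedHom_phi_comp_pullback g K a b hK hK' (extMulAtiyahPower X₁ K q x)
    rw [phiMulAtiyahPower, phiMulAtiyahPower, reassoc_of% h3, ← hy, shiftedHomMap_comp_mk₀, ShiftedHom.comp_mk₀]
  -- (Q2) and (Q5) after `Q`
  have h2 : Q.map (((Scheme.Modules.pullback g.left).mapHomologicalComplex (ComplexShape.up ℤ)).map (unit X₁.left K a b)) ≫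
      Q.map (homFunctorPullbackHomApp g.left K K) =
      Q.map (pullbackUnitSingleComparison g) ≫
        Q.map (unit X₀.left (((Scheme.Modules.pullback g.left).mapHomologicalComplex (ComplexShape.up ℤ)).obj K) a b) := by
    rw [← Functor.map_comp, ← Functor.map_comp, map_unit_comp_pullback g K a b]
  have h5 : (shiftFunctor _ ((q : ℤ) + 2)).map (Q.map (((Scheme.Modules.pullback g.left).mapHomologicalComplex (ComplexShape.up ℤ)).map
      (supertraceH X₁ K hK q))) ≫ (shiftFunctor _ ((q : ℤ) + 2)).map (Q.map (pullbackFormsSingleComparison g q)) =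
      (shiftFunctor _ ((q : ℤ) + 2)).map (Q.map (homFunctorPullbackHomApp g.left K (twistHodgeComplex X₁ q K))) ≫
        (shiftFunctor _ ((q : ℤ) + 2)).map (Q.map ((homFunctor X₀.left _).map (twistHodgeComplexPullbackHom g q K hK))) ≫
          (shiftFunctor _ ((q : ℤ) + 2)).map (Q.map (supertraceH X₀ (((Scheme.Modules.pullback g.left).mapHomologicalComplex
            (ComplexShape.up ℤ)).obj K) hK' q)) := by
    simp only [← Functor.map_comp, map_supertraceH_comp_pullbackFormsSingleComparison g K hK hK' q]
  -- assemble
  rw [sigmaC, sigmaC, mapShiftedHom_comp, mapShiftedHom_comp, unitQ, unitQ, mapShiftedHom_mk₀, mapShiftedHom_mk₀, comp_sigmaShape,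
    sigmaShape_comp]
  refine shiftedHom_comp_mk₀_congr _ _ _ _ _ ?_
  rw [ShiftedHom.mk₀_comp, ShiftedHom.mk₀_comp, Category.assoc, Category.assoc, ← reassoc_of% h2, ← reassoc_of% hΦ]
  simp only [Functor.map_comp, Category.assoc]
  rw [h5]

end Sigma

/-! ## §3 (Dq-σ)'s body at every secant quotient datum -/

section Datum

/-- **(Dq-σ) AT ONE COMPLEX — THE BODY OF `SigmaDescent.SigmaPullbackCompatAt D E`, PROVED**: for a secant quotient datum `D` (quotient isogeny
`q : P = J × Ĵ ⟶ Y`, exact pull-back `q^*` — an isogeny is flat), a complex `E` on `Y` in `[a, b]` with vector-bundle terms, every `q₀` and every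
`x ∈ Ext²_Y(E, E)`: `[u] ≫ σ_{q₀}^{q^*E}(q^{**}x) = q^{**}(σ_{q₀}^{E}(x)) ≫ [dq]⟦q₀+2⟧` in the route's ambient `HasDerivedCategory.standard`, with
`q^{**} = mapShiftedHom (pullback q)`, `u`, `dq` the bodies of `SigmaDescent.pullbackExt ∕ unitSingleComparison ∕ formsSingleComparison`.
[cite: BuchweitzFlenner2003, §3 and Def. 4.1] [cite: Markman2025SecantWeil, §9.3 Lemma 9.3.9] [cite: StacksProject, Tag 02N2] -/
theorem sigmaPullbackCompatAt_body (D : SecantQuotientDatum) (E : CochainComplex D.Y.X.left.Modules ℤ) (a b : ℤ) [E.IsStrictlyGE a]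
    [E.IsStrictlyLE b] (hE : ∀ i, IsFiniteLocallyFree (E.X i)) (q₀ : ℕ) :
    letI := HasDerivedCategory.standard D.Y.X.left.Modules
    letI := HasDerivedCategory.standard D.P.X.left.Modules
    haveI := D.isIsogeny_q.preservesFiniteLimits_pullback
    ∀ x : ShiftedHom (Q.obj E) (Q.obj E) (2 : ℤ),
      Q.map (pullbackUnitSingleComparison D.q.hom.hom.hom) ≫
          sigmaC D.P.X (quotientPullbackComplex D E) a b (fun i => (hE i).pullback (Hom.toSchemeHom D.q)) q₀
            (mapShiftedHom (Scheme.Modules.pullback (Hom.toSchemeHom D.q)) x) =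
        mapShiftedHom (Scheme.Modules.pullback (Hom.toSchemeHom D.q)) (sigmaC D.Y.X E a b hE q₀ x) ≫
          (Q.map (pullbackFormsSingleComparison D.q.hom.hom.hom q₀))⟦((q₀ + 2 : ℕ) : ℤ)⟧' := by
  letI := HasDerivedCategory.standard D.Y.X.left.Modules
  letI := HasDerivedCategory.standard D.P.X.left.Modules
  haveI := D.isIsogeny_q.preservesFiniteLimits_pullback
  intro x
  exact mapShiftedHom_sigmaC_pullback D.q.hom.hom.hom E a b hE (fun i => (hE i).pullback (Hom.toSchemeHom D.q)) q₀ x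

end Datum

end Summit.HodgeConjecture.HodgeConjecture.Ring2.SemiregularRepresentatives

end
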